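import Summits.NavierStokesRegularity.NavierStokesRegularity.Theorems.SqueezeCycleSingularProfileOfNontrivialMorreySlice
import Literature.Analysis.FluidPDE.TypeIAncientMild
import Literature.Analysis.FluidPDE.ClassicalSolutionRescale
import Literature.Analysis.FluidPDE.ClassicalSolutionGlue
import Literature.Analysis.FluidPDE.LocalTypeIScaling
import Literature.Analysis.FluidPDE.LocalTypeICongr
import Summits.NavierStokesRegularity.NavierStokesRegularity.Theorems.SqueezeCycleExtremalElementExists

/-!
# Route SqueezeCycle · item `SingularProfileOfNontrivial` (stmt-NavierStokesRegularity-15368):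
# the Type-I model class 𝒦_C — Morrey bound, invariances, unit-ball bookkeeping

Helper file (theorems only). The class 𝒦_C of route SqueezeCycle is `IsTypeIAncientMild C u` plus the
scaled-energy clause `A, E ≤ C` (top times `t₀ ≤ 0`). Recorded here: the scale-invariant Morrey bound
`∫_{B(x,r)}|u(t)|² ≤ C r` at every `t < 0`; invariance of the clause under past time shifts and of the whole
class (with a classical pressure) under the Navier–Stokes zoom about any `(t₀, x₀)`, `t₀ ≤ 0`
(`modelClass_zoom`); Tonelli / measurability on the unit parabolic ball `Q(0,1) = (−1,0) × B(0,1)`,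
continuity in time of the unit-ball mean of a jointly continuous pressure, the singular time weight
`∫_{(−1,0)}(−t)^{−1/2} dt ≤ 2`, and small lemmas on zoomed gradients.

References: T. Tao, Anal. PDE 6 (2013), §4, proof of Lemma 4.1 (i) [Tao2011]; D. Albritton, T. Barker,
J. Math. Fluid Mech. 21 (2019) = arXiv:1811.00502, §1, §3 [AlbrittonBarker2019]; G. Koch, N. Nadirashvili,
G. Seregin, V. Šverák, Acta Math. 203 (2009) [KochNadirashviliSereginSverak2009].
-/

noncomputable section

-- the sub-problem namespace repeats the summit name (D-0017 layout `Summit.<S>.<P>.Theorems`)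
set_option linter.dupNamespace false
-- nested operator types `ℝ³ →L[ℝ] ℝ³ →L[ℝ] ℝ³ →L[ℝ] ℝ` (pressure kernels)
set_option maxSynthPendingDepth 3

namespace Summit.NavierStokesRegularity.NavierStokesRegularity.Theorems.SingularProfile

open MeasureTheory Set Filter Metric Function
open _root_.Topology
open scoped ENNReal NNReal Laplacian ContDiff RealInnerProductSpace
open Literature.Analysis.FluidPDE
open Literature.Analysis.FluidPDE.FourierNS (HasDecay)

variable {C : ℝ} {u : ℝ → (EuclideanSpace ℝ (Fin 3)) → (EuclideanSpace ℝ (Fin 3))}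
  {q : ℝ → (EuclideanSpace ℝ (Fin 3)) → ℝ}

/-- **The scale-invariant Morrey bound of a class member at every negative time**: from the
scaled-energy clause `A ≤ C` of 𝒦_C (top times `t₀ ≤ 0`), `∫_{B(x,r)} |u(t)|² ≤ C r` for all
`t < 0`, `x`, `r > 0` (choose the ball with top time `min(0, t + r²/2)`). [cite: AlbrittonBarker2019, §1] -/
theorem morrey_of_energyClause
    (h5 : ∀ (x₀ : EuclideanSpace ℝ (Fin 3)) (t₀ r : ℝ), t₀ ≤ 0 → 0 < r →
      (∀ t, t₀ - r ^ 2 < t → t < t₀ → r⁻¹ * ∫ x in ball x₀ r, ‖u t x‖ ^ 2 ≤ C) ∧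
        r⁻¹ * ∫ t in Ioo (t₀ - r ^ 2) t₀, ∫ x in ball x₀ r, ‖fderiv ℝ (u t) x‖ ^ 2 ≤ C)
    {t : ℝ} (ht : t < 0) (x : EuclideanSpace ℝ (Fin 3)) {r : ℝ} (hr : 0 < r) :
    ∫ y in ball x r, ‖u t y‖ ^ 2 ≤ C * r := by
  set t₀ : ℝ := min 0 (t + r ^ 2 / 2) with ht₀def
  have ht₀ : t₀ ≤ 0 := min_le_left _ _
  have h1 : t₀ - r ^ 2 < t := by
    have : t₀ ≤ t + r ^ 2 / 2 := min_le_right _ _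
    nlinarith
  have h2 : t < t₀ := lt_min ht (by nlinarith)
  have h := (h5 x t₀ r ht₀ hr).1 t h1 h2
  rw [inv_mul_le_iff₀ hr] at h
  rwa [mul_comm] at h

/-- **The scaled-energy clause is invariant under time shifts into the past.** [folklore] -/
theorem energyClause_comp_sub
    (h5 : ∀ (x₀ : EuclideanSpace ℝ (Fin 3)) (t₀ r : ℝ), t₀ ≤ 0 → 0 < r →
      (∀ t, t₀ - r ^ 2 < t → t < t₀ → r⁻¹ * ∫ x in ball x₀ r, ‖u t x‖ ^ 2 ≤ C) ∧
        r⁻¹ * ∫ t in Ioo (t₀ - r ^ 2) t₀, ∫ x in ball x₀ r, ‖fderiv ℝ (u t) x‖ ^ 2 ≤ C)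
    {δ : ℝ} (hδ : 0 ≤ δ) :
    ∀ (x₀ : EuclideanSpace ℝ (Fin 3)) (t₀ r : ℝ), t₀ ≤ 0 → 0 < r →
      (∀ t, t₀ - r ^ 2 < t → t < t₀ →
        r⁻¹ * ∫ x in ball x₀ r, ‖(fun s => u (s - δ)) t x‖ ^ 2 ≤ C) ∧
        r⁻¹ * ∫ t in Ioo (t₀ - r ^ 2) t₀, ∫ x in ball x₀ r,
          ‖fderiv ℝ ((fun s => u (s - δ)) t) x‖ ^ 2 ≤ C := by
  intro x₀ t₀ r ht₀ hr
  have h := h5 x₀ (t₀ - δ) r (by linarith) hr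
  refine ⟨fun t h1 h2 => h.1 (t - δ) (by linarith) (by linarith), ?_⟩
  have hpre : (fun t : ℝ => t + -δ) ⁻¹' Ioo (t₀ - δ - r ^ 2) (t₀ - δ) = Ioo (t₀ - r ^ 2) t₀ := by
    ext t
    simp only [mem_preimage, mem_Ioo]
    constructor <;> intro h' <;> constructor <;> linarith [h'.1, h'.2]
  have e : ∫ t in Ioo (t₀ - r ^ 2) t₀, ∫ x in ball x₀ r, ‖fderiv ℝ ((fun s => u (s - δ)) t) x‖ ^ 2 =
      ∫ s in Ioo (t₀ - δ - r ^ 2) (t₀ - δ), ∫ x in ball x₀ r, ‖fderiv ℝ (u s) x‖ ^ 2 := by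
    rw [← hpre]
    have h1 := (measurePreserving_add_right volume (-δ)).setIntegral_preimage_emb
      (Homeomorph.addRight (-δ)).measurableEmbedding
      (fun s => ∫ x in ball x₀ r, ‖fderiv ℝ (u s) x‖ ^ 2) (Ioo (t₀ - δ - r ^ 2) (t₀ - δ))
    simpa only [sub_eq_add_neg] using h1
  rw [e]
  exact h.2

/-- **The class 𝒦_C (with a classical pressure) is invariant under the Navier–Stokes zoom about
any point `(t₀, x₀)` with `t₀ ≤ 0`**: `(s, y) ↦ c u(t₀ + c²s, x₀ + c y)` is again Type-I ancient
mild with the same constant, obeys the same scaled-energy clause, and `c² q ∘ Φ` is a classical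
pressure for it on `(−∞, 0)` (zoom about `(0, x₀)` of the past-shifted field `u(· + t₀)`:
`isTypeIAncientMild_zoom`, `energyBounds_zoom`, `IsClassicalNSSolutionOn.nsRescale_translate_zero`).
[cite: KochNadirashviliSereginSverak2009, §1 (1.2) (arXiv:0709.3599 p. 2)] -/
theorem modelClass_zoom (hK : IsTypeIAncientMild C u)
    (h5 : ∀ (x₀ : EuclideanSpace ℝ (Fin 3)) (t₀ r : ℝ), t₀ ≤ 0 → 0 < r →
      (∀ t, t₀ - r ^ 2 < t → t < t₀ → r⁻¹ * ∫ x in ball x₀ r, ‖u t x‖ ^ 2 ≤ C) ∧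
        r⁻¹ * ∫ t in Ioo (t₀ - r ^ 2) t₀, ∫ x in ball x₀ r, ‖fderiv ℝ (u t) x‖ ^ 2 ≤ C)
    (hq : IsClassicalNSSolutionOn (Iio 0) 1 0 u q) {c : ℝ} (hc : 0 < c) {t₀ : ℝ} (ht₀ : t₀ ≤ 0)
    (x₀ : EuclideanSpace ℝ (Fin 3)) :
    IsTypeIAncientMild C (c • stPull (c ^ 2) c t₀ x₀ u) ∧
    (∀ (y₀ : EuclideanSpace ℝ (Fin 3)) (s₀ r : ℝ), s₀ ≤ 0 → 0 < r →
      (∀ s, s₀ - r ^ 2 < s → s < s₀ →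
        r⁻¹ * ∫ y in ball y₀ r, ‖(c • stPull (c ^ 2) c t₀ x₀ u) s y‖ ^ 2 ≤ C) ∧
        r⁻¹ * ∫ s in Ioo (s₀ - r ^ 2) s₀, ∫ y in ball y₀ r,
          ‖fderiv ℝ ((c • stPull (c ^ 2) c t₀ x₀ u) s) y‖ ^ 2 ≤ C) ∧
    IsClassicalNSSolutionOn (Iio 0) 1 0 (c • stPull (c ^ 2) c t₀ x₀ u)
      (c ^ 2 • stPull (c ^ 2) c t₀ x₀ q) := by
  -- the past shift `u' = u(· + t₀)`
  set δ : ℝ := -t₀ with hδ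
  have hδ0 : 0 ≤ δ := by rw [hδ]; linarith
  have hK' : IsTypeIAncientMild C (fun s => u (s - δ)) := hK.comp_sub_right hδ0
  have h5' := energyClause_comp_sub h5 hδ0
  have e : stPull (c ^ 2) c t₀ x₀ u = stPull (c ^ 2) c 0 x₀ (fun s => u (s - δ)) := by
    funext s y
    simp only [stPull_apply, hδ]
    congr 1
    ring
  have e' : c • stPull (c ^ 2) c t₀ x₀ u = c • stPull (c ^ 2) c 0 x₀ (fun s => u (s - δ)) := by
    rw [e]
  refine ⟨?_, ?_, ?_⟩
  · rw [e']; exact isTypeIAncientMild_zoom hK' hc x₀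
  · rw [e']; exact energyBounds_zoom hK' h5' hc x₀
  · have h := hq.nsRescale_translate_zero hc t₀ x₀
    refine h.mono (fun s (hs : s < 0) => ?_) (uniqueDiffOn_Iio 0)
    show t₀ + c ^ 2 * s < 0
    nlinarith [mul_pos (pow_pos hc 2) (neg_pos.2 hs)]

/-- `Q(0, 1) = (−1, 0) × B(0, 1)`. [folklore] -/
theorem parabolicCylinder_one_zero :
    parabolicCylinder 1 (0 : ℝ × EuclideanSpace ℝ (Fin 3)) =
      Ioo (-1 : ℝ) 0 ×ˢ ball (0 : EuclideanSpace ℝ (Fin 3)) 1 := by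
  ext w
  simp [parabolicCylinder, mem_prod]

/-- **Tonelli on the unit parabolic ball** for an a.e.-measurable integrand. [folklore] -/
theorem lintegral_parabolicCylinder_one_eq {F : ℝ × EuclideanSpace ℝ (Fin 3) → ℝ≥0∞}
    (hF : AEMeasurable F (volume.restrict (parabolicCylinder 1 (0 : ℝ × EuclideanSpace ℝ (Fin 3))))) :
    ∫⁻ w in parabolicCylinder 1 (0 : ℝ × EuclideanSpace ℝ (Fin 3)), F w =
      ∫⁻ t in Ioo (-1 : ℝ) 0, ∫⁻ x in ball (0 : EuclideanSpace ℝ (Fin 3)) 1, F (t, x) := by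
  rw [parabolicCylinder_one_zero] at hF ⊢
  rw [Measure.volume_eq_prod, ← Measure.prod_restrict] at hF ⊢
  exact lintegral_prod _ hF

/-- A function continuous on the open slab `(−∞,0) × ℝ³` is a.e.-measurable on `Q(0,1)` (after
composition with a measurable map, e.g. `ENNReal.ofReal`, `‖·‖ₑ ^ p`). [folklore] -/
theorem aemeasurable_parabolicCylinder_one_of_continuousOn {β : Type*} [MeasurableSpace β]
    [TopologicalSpace β] [TopologicalSpace.PseudoMetrizableSpace β] [BorelSpace β]
    {f : ℝ × EuclideanSpace ℝ (Fin 3) → β}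
    (hf : ContinuousOn f (Iio (0 : ℝ) ×ˢ (univ : Set (EuclideanSpace ℝ (Fin 3))))) :
    AEMeasurable f (volume.restrict (parabolicCylinder 1 (0 : ℝ × EuclideanSpace ℝ (Fin 3)))) := by
  refine (hf.mono ?_).aemeasurable (isOpen_parabolicCylinder 1 0).measurableSet
  exact parabolicCylinder_origin_subset_slab 1

/-- **Continuity in time of the unit-ball mean of a jointly continuous pressure** on `(−∞,0)`
(dominated convergence on a compact time neighbourhood). [folklore] -/
theorem continuousOn_ballMean {q : ℝ → EuclideanSpace ℝ (Fin 3) → ℝ}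
    (hq : ContinuousOn (uncurry q) (Iio (0 : ℝ) ×ˢ (univ : Set (EuclideanSpace ℝ (Fin 3))))) :
    ContinuousOn (fun t => ⨍ y in ball (0 : EuclideanSpace ℝ (Fin 3)) 1, q t y) (Iio 0) := by
  have e : (fun t => ⨍ y in ball (0 : EuclideanSpace ℝ (Fin 3)) 1, q t y) =
      fun t => (volume.real (ball (0 : EuclideanSpace ℝ (Fin 3)) 1))⁻¹ *
        ∫ y in ball (0 : EuclideanSpace ℝ (Fin 3)) 1, q t y := by
    funext t
    rw [setAverage_eq, smul_eq_mul]
  rw [e]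
  refine continuousOn_const.mul ?_
  intro t₁ ht₁
  have ht₁' : t₁ < 0 := ht₁
  -- a compact time neighbourhood `[t₁ - ε, t₁ + ε] ⊆ (−∞, 0)`
  set ε : ℝ := -t₁ / 2 with hε
  have hε0 : 0 < ε := by rw [hε]; linarith
  have hIcc : Icc (t₁ - ε) (t₁ + ε) ⊆ Iio (0 : ℝ) := fun t ht => by
    show t < 0
    have := ht.2
    rw [hε] at this
    linarith
  -- bound on the compact set
  have hKc : IsCompact (Icc (t₁ - ε) (t₁ + ε) ×ˢ closedBall (0 : EuclideanSpace ℝ (Fin 3)) 1) :=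
    isCompact_Icc.prod (isCompact_closedBall 0 1)
  obtain ⟨M, hM⟩ := hKc.exists_bound_of_continuousOn
    (hq.mono (prod_mono hIcc (subset_univ _)))
  have hnhds : Icc (t₁ - ε) (t₁ + ε) ∈ 𝓝[Iio 0] t₁ :=
    mem_nhdsWithin_of_mem_nhds (Icc_mem_nhds (by linarith) (by linarith))
  refine ContinuousWithinAt.congr_of_eventuallyEq ?_ (Eventually.of_forall fun _ => rfl) rfl
  refine continuousWithinAt_of_dominated (bound := fun _ => M) ?_ ?_ ?_ ?_
  · filter_upwards [hnhds] with t ht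
    exact ((hq.comp (Continuous.prodMk_right t).continuousOn
      (fun y _ => ⟨hIcc ht, mem_univ y⟩)).mono (subset_univ _)).aestronglyMeasurable
      measurableSet_ball
  · filter_upwards [hnhds] with t ht
    refine (ae_restrict_mem measurableSet_ball).mono fun y hy => ?_
    exact hM (t, y) ⟨ht, ball_subset_closedBall hy⟩
  · exact integrableOn_const measure_ball_lt_top.ne
  · refine (ae_restrict_mem measurableSet_ball).mono fun y _ => ?_
    have hcont : ContinuousAt (fun t => q t y) t₁ := by
      have h1 : ContinuousAt (uncurry q) (t₁, y) :=
        hq.continuousAt ((isOpen_Iio.prod isOpen_univ).mem_nhds ⟨ht₁', mem_univ y⟩)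
      have h2 : ContinuousAt (fun t : ℝ => (t, y)) t₁ := (continuous_id.prodMk continuous_const).continuousAt
      exact ContinuousAt.comp (f := fun t : ℝ => (t, y)) h1 h2
    exact hcont.continuousWithinAt

/-- **The singular time weight**: `∫_{(−1,0)} (−t)^{−1/2} dt ≤ 2`, in `ℝ≥0∞`. [folklore] -/
theorem lintegral_Ioo_rpow_neg_half_le :
    ∫⁻ t in Ioo (-1 : ℝ) 0, ENNReal.ofReal ((-t) ^ (-(2⁻¹ : ℝ))) ≤ ENNReal.ofReal 2 := by
  have hr : (-1 : ℝ) < -(2⁻¹ : ℝ) := by norm_num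
  -- integrability of `t ↦ (−t)^{−1/2}` on `(−1, 0)`
  have hii : IntervalIntegrable (fun t : ℝ => (0 - t) ^ (-(2⁻¹ : ℝ))) volume (0 - 0) (0 - 1) :=
    (intervalIntegral.intervalIntegrable_rpow' hr (a := 0) (b := 1)).comp_sub_left 0
  simp only [sub_zero, zero_sub] at hii
  have hint : IntegrableOn (fun t : ℝ => (-t) ^ (-(2⁻¹ : ℝ))) (Ioo (-1 : ℝ) 0) volume := by
    have h := hii.def'
    rw [show Set.uIoc (0 : ℝ) (-1) = Ioc (-1) 0 by rw [Set.uIoc_of_ge (by norm_num)]] at h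
    exact h.mono_set Ioo_subset_Ioc_self
  have hnn : ∀ t ∈ Ioo (-1 : ℝ) 0, 0 ≤ (-t) ^ (-(2⁻¹ : ℝ)) := fun t ht =>
    Real.rpow_nonneg (by linarith [ht.2]) _
  rw [← ofReal_integral_eq_lintegral_ofReal hint
    ((ae_restrict_mem measurableSet_Ioo).mono hnn)]
  refine ENNReal.ofReal_le_ofReal ?_
  -- the value of the integral
  have e1 : ∫ t in Ioo (-1 : ℝ) 0, (-t) ^ (-(2⁻¹ : ℝ)) = ∫ t in (-1 : ℝ)..0, (-t) ^ (-(2⁻¹ : ℝ)) := by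
    rw [intervalIntegral.integral_of_le (by norm_num), integral_Ioc_eq_integral_Ioo]
  have e2 : ∫ t in (-1 : ℝ)..0, (-t) ^ (-(2⁻¹ : ℝ)) = ∫ s in (0 : ℝ)..1, s ^ (-(2⁻¹ : ℝ)) := by
    rw [intervalIntegral.integral_comp_neg (fun s : ℝ => s ^ (-(2⁻¹ : ℝ)))]
    norm_num
  rw [e1, e2, integral_rpow (Or.inl hr)]
  norm_num

/-- Bochner-to-Lebesgue conversion of the local energy of a continuous slice. [folklore] -/
theorem lintegral_ball_enorm_sq_eq {v : (EuclideanSpace ℝ (Fin 3)) → (EuclideanSpace ℝ (Fin 3))}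
    (hv : Continuous v) (x₀ : EuclideanSpace ℝ (Fin 3)) (r : ℝ) :
    ∫⁻ x in ball x₀ r, ‖v x‖ₑ ^ 2 = ENNReal.ofReal (∫ x in ball x₀ r, ‖v x‖ ^ 2) := by
  have hint : IntegrableOn (fun x => ‖v x‖ ^ 2) (ball x₀ r) volume :=
    ((hv.norm.pow 2).continuousOn.integrableOn_compact (isCompact_closedBall x₀ r)).mono_set
      ball_subset_closedBall
  rw [ofReal_integral_eq_lintegral_ofReal hint (ae_of_all _ fun _ => sq_nonneg _)]
  refine lintegral_congr fun x => ?_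
  rw [← ofReal_norm, ENNReal.ofReal_pow (norm_nonneg _)]

/-- The gradient of a zoomed slice about `(t₀, x₀)`: `∇(c u(t₀ + c²s, x₀ + c ·))(y) = c² ∇u(t₀ + c²s)(x₀ + c y)`
when the slice is differentiable (as the tree's `fderiv_zoom`, centre `t₀`). [folklore] -/
theorem fderiv_zoom_center {c t₀ : ℝ} (x₀ : EuclideanSpace ℝ (Fin 3))
    (u : ℝ → EuclideanSpace ℝ (Fin 3) → EuclideanSpace ℝ (Fin 3)) {s : ℝ}
    (hd : Differentiable ℝ (u (t₀ + c ^ 2 * s))) (y : EuclideanSpace ℝ (Fin 3)) :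
    fderiv ℝ ((c • stPull (c ^ 2) c t₀ x₀ u) s) y =
      (c ^ 2) • fderiv ℝ (u (t₀ + c ^ 2 * s)) (x₀ + c • y) := by
  have hd' : Differentiable ℝ (stPull (c ^ 2) c t₀ x₀ u s) := differentiable_stPull_slice hd
  rw [show (c • stPull (c ^ 2) c t₀ x₀ u) s = fun z => c • stPull (c ^ 2) c t₀ x₀ u s z from rfl,
    fderiv_fun_const_smul (hd' y), fderiv_stPull, smul_smul, sq]

/-- `E` only sees the gradient on the ball. [folklore] -/
theorem cknE_congr_on {r : ℝ} {z : ℝ × EuclideanSpace ℝ (Fin 3)}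
    {G G' : ℝ → (EuclideanSpace ℝ (Fin 3)) → (EuclideanSpace ℝ (Fin 3)) →L[ℝ] (EuclideanSpace ℝ (Fin 3))}
    (h : ∀ w ∈ parabolicCylinder r z, G w.1 w.2 = G' w.1 w.2) : cknE r z G = cknE r z G' := by
  unfold cknE
  congr 1
  exact setLIntegral_congr_fun (isOpen_parabolicCylinder r z).measurableSet fun w hw => by rw [h w hw]

end Summit.NavierStokesRegularity.NavierStokesRegularity.Theorems.SingularProfile
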